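import Literature.Topology.PlanarFoliations.HugWalk
import Literature.Topology.PlanarFoliations.HugFrame
import HarnessLib

/-!
# The hugged walk of a hugging frame

Topic: Topology / PlanarFoliations, the generic form of `HugWalk.lean` over a hugging frame
(`HugFrame.lean`): the chain of compact leaves and the frontier of its limit set are replaced by an
abstract hugger `A` and hugged set `G`. Verbatim ports, with `HugHyp`, `HugState`, `HugData`,
`Dart.Good` replaced by `HugFrame`, `FState`, `FData`, `Dart.FGood`:

* `Dart.FGood` (**structure**, `Prop`): the exit point of the dart is in `G` with line leaf, whose
  α-limit set is the saddle and which has a backward tail on the dart's prong based at the exit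
  point;
* `StarData.FData` (**structure**): a state with a chosen forward tail; `FState.canonData`;
  `FData.junction s`, `FData.next s hg`, `FData.next_eq_of_outDart_eq`, `FData.link`,
  `FData.seq`, `FData.hugJ`, `FData.hugLink` and their API, as in `HugWalk.lean` (the darts
  `StarData.Dart` and the junk paths `WalkJunction.junkPath` are reused from there).

## References

* C. Camacho, A. Lins Neto, *Geometric Theory of Foliations*, Birkhäuser (1985), Ch. VII §2
  [CamachoLinsNeto1985].
-/

noncomputable section

open Set Filter Function Metric unitInterval
open _root_.Topology
open Literature.Topology.FourManifolds Literature.Topology.FourManifolds.Foliation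

namespace Literature.Topology.PlanarFoliations

variable {X : Type*} [TopologicalSpace X] [T2Space X] [SecondCountableTopology X] [Nonempty X] {F : Foliation ℝ X} {ι : X → ℂ}
variable {B : Type*} [NormedAddCommGroup B] {M : Type*} [TopologicalSpace M] {T : Foliation B M} {g : ℂ → M}

namespace StarData

variable {D : StarData F ι T g} (hι : IsOpenEmbedding ι)

namespace Dart

variable (dt : D.Dart)

/-- **A good dart**: its exit point is a frontier point of the limit set with line leaf, whose
α-limit set is the saddle, and the whole prong arc is a backward tail of that leaf. [folklore] -/
structure FGood (hbi : IsBiOriented F) (G : Set ℂ) : Prop where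
  /-- the leaf of the exit point is a line leaf -/
  nc : NoncompactSpace (F.Leaf (dt.exitPt hι))
  /-- the exit point is a frontier point -/
  fr : ι (dt.exitPt hι) ∈ G
  /-- the α-limit set of its leaf is the saddle -/
  α : alphaSet hbi ι (dt.exitPt hι) = {dt.v}
  /-- the whole prong arc is a backward tail -/
  eb : ∃ Eb : dt.P.BwdTail hbi (dt.exitPt hι), Eb.j = dt.j ∧ Eb.β₀ = dt.P.ρ


end Dart


/-! ## States with a chosen arrival tail -/

variable {hbi : IsBiOriented F} {hι} {C G : Set ℂ} {A : ℕ → X}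

/-- **The data of a state of the hugged walk**: a frontier point and a forward tail of its leaf at
the arrival saddle. [folklore] -/
structure FData (Fr : D.HugFrame hbi hι C G A) where
  /-- the state -/
  st : FState ι F G
  /-- the chosen arrival tail -/
  E : haveI := (Fr.sep _ st.hy).1; (D.star _ (st.hv Fr)).FwdTail hbi st.y

variable (Fr : D.HugFrame hbi hι C G A)

namespace FState

variable (st : FState ι F G)

/-- The arrival saddle is in the ω-limit set. [folklore] -/
theorem v_mem_omegaSet : haveI := (Fr.sep _ st.hy).1; st.v Fr ∈ omegaSet hbi ι st.y := by
  rw [st.omegaSet_eq Fr]; exact mem_singleton _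

/-- **There is an arrival tail based after the base point.** [folklore] -/
theorem exists_fwdTail_gt :
    haveI := (Fr.sep _ st.hy).1; ∃ E : (D.star _ (st.hv Fr)).FwdTail hbi st.y, leafLT hbi (Leaf.base F st.y) E.p := by
  haveI := (Fr.sep _ st.hy).1
  exact (st.Ef Fr).exists_gt hι (st.v_mem_omegaSet Fr) (Leaf.base F st.y)

/-- **The canonical data of a state**: the arrival tail chosen beyond the base point. [folklore] -/
def canonData : FData Fr := ⟨st, (st.exists_fwdTail_gt Fr).choose⟩

/-- The canonical data have the given state. [folklore] -/
@[simp] theorem canonData_st : (st.canonData Fr).st = st := rfl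

end FState

namespace Dart

/-- **The next data of a good dart**: the canonical data of its exit point. [folklore] -/
def fnextData (dt : D.Dart) (hg : dt.FGood hι hbi G) : FData Fr := FState.canonData Fr ⟨dt.exitPt hι, hg.fr⟩

/-- The point of the next data is the exit point. [folklore] -/
@[simp] theorem fnextData_y (dt : D.Dart) (hg : dt.FGood hι hbi G) : (dt.fnextData Fr hg).st.y = dt.exitPt hι := rfl

end Dart

namespace FData

variable {Fr} (fd : FData Fr)

/-- The arrival saddle. [folklore] -/
def v : ℂ := fd.st.v Fr

/-- The arrival saddle is a saddle. [folklore] -/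
theorem hv : D.nprong fd.v ≠ 0 := fd.st.hv Fr

/-- The number of prongs at the arrival saddle is not zero. [folklore] -/
instance : NeZero (D.nprong fd.v) := ⟨fd.hv⟩

/-- The star of the arrival saddle. [folklore] -/
abbrev P : ProngStar F ι fd.v (D.nprong fd.v) := D.star _ fd.hv

/-- The state's leaf is a line leaf (an instance keyed by the state data). [folklore] -/
instance nc : NoncompactSpace (F.Leaf fd.st.y) := (Fr.sep _ fd.st.hy).1

/-- The canonical tail is based after the base point. [folklore] -/
theorem _root_.Literature.Topology.PlanarFoliations.StarData.FState.base_lt_canonData_p (st : FState ι F G) :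
    leafLT hbi (Leaf.base F (st.canonData Fr).st.y) (st.canonData Fr).E.p :=
  (st.exists_fwdTail_gt Fr).choose_spec

/-- **The arrival prong.** [folklore] -/
def jin : ZMod (D.nprong fd.v) := fd.E.j

/-- **The arrival dart.** [folklore] -/
def dart : D.Dart := ⟨fd.v, fd.hv, fd.jin⟩

/-- **The out-dart** on the side `s`. [folklore] -/
def outDart (s : ℝ) : D.Dart := fd.dart.turn s

/-- **The outgoing prong** on the side `s`. [folklore] -/
def jout (s : ℝ) : ZMod (D.nprong fd.v) := (fd.outDart s).j

/-- The outgoing prong by the turning rule. [folklore] -/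
theorem jout_eq (s : ℝ) : fd.jout s = if 0 ≤ fd.P.sg fd.jin * s then fd.jin + 1 else fd.jin - 1 := rfl

/-- The outgoing prong is a neighbour of the arrival prong. [folklore] -/
theorem jout_eq_or (s : ℝ) : fd.jout s = fd.jin + 1 ∨ fd.jout s = fd.jin - 1 := by
  rw [fd.jout_eq]; split_ifs <;> simp

/-- The out-dart is at the arrival saddle. [folklore] -/
@[simp] theorem outDart_v (s : ℝ) : (fd.outDart s).v = fd.v := rfl

/-- The prong of the out-dart is the outgoing prong. [folklore] -/
@[simp] theorem outDart_j (s : ℝ) : (fd.outDart s).j = fd.jout s := rfl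

/-- The arrival dart is at the arrival saddle. [folklore] -/
@[simp] theorem dart_v : fd.dart.v = fd.v := rfl

/-- The prong of the arrival dart is the arrival prong. [folklore] -/
@[simp] theorem dart_j : fd.dart.j = fd.jin := rfl

/-- The arrival saddle is in the ω-limit set. [folklore] -/
theorem v_mem_omegaSet : fd.v ∈ omegaSet hbi ι fd.st.y := fd.st.v_mem_omegaSet Fr

/-! ### The junction -/

/-- The prong-box bound at the prong `j`. [folklore] -/
def βbox (j : ZMod (D.nprong fd.v)) : ℝ := (fd.P.exists_prongBox hι j).choose

/-- The prong-box bound is positive, at most `ρ`, and prong boxes exist below it. [folklore] -/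
theorem βbox_spec (j : ZMod (D.nprong fd.v)) :
    fd.βbox j ∈ Ioc 0 fd.P.ρ ∧ ∀ β ∈ Ioc 0 (fd.βbox j), Nonempty (ProngBox fd.P hι j β) :=
  (fd.P.exists_prongBox hι j).choose_spec

/-- **The parameter of the junction**: below half the tail parameter and below the prong-box
bounds of `jin`, `jin + 1`, `jin - 1`. [folklore] -/
def β : ℝ := min (fd.E.β₀ / 2) (min (fd.βbox fd.jin) (min (fd.βbox (fd.jin + 1)) (fd.βbox (fd.jin - 1))))

/-- The parameter of the junction is positive. [folklore] -/
theorem β_pos : 0 < fd.β :=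
  lt_min (half_pos fd.E.hβ₀.1) (lt_min (fd.βbox_spec _).1.1 (lt_min (fd.βbox_spec _).1.1 (fd.βbox_spec _).1.1))

/-- The parameter of the junction is below the tail parameter. [folklore] -/
theorem β_lt_β₀ : fd.β < fd.E.β₀ := (min_le_left _ _).trans_lt (half_lt_self fd.E.hβ₀.1)

/-- The parameter of the junction is in `(0, β₀]`. [folklore] -/
theorem β_mem_Ioc : fd.β ∈ Ioc 0 fd.E.β₀ := ⟨fd.β_pos, fd.β_lt_β₀.le⟩

/-- The parameter of the junction is below `ρ`. [folklore] -/
theorem β_lt_ρ : fd.β < fd.P.ρ := fd.β_lt_β₀.trans_le fd.E.hβ₀.2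

/-- The parameter of the junction is in `(0, ρ)`. [folklore] -/
theorem β_mem_Ioo : fd.β ∈ Ioo 0 fd.P.ρ := ⟨fd.β_pos, fd.β_lt_ρ⟩

/-- The parameter of the junction is in `(0, ρ]`. [folklore] -/
theorem β_mem_Ioc_ρ : fd.β ∈ Ioc 0 fd.P.ρ := ⟨fd.β_pos, fd.β_lt_ρ.le⟩

/-- The parameter of the junction is in `[0, ρ]`. [folklore] -/
theorem hβ : fd.β ∈ Icc 0 fd.P.ρ := ⟨fd.β_pos.le, fd.β_lt_ρ.le⟩

/-- The parameter of the junction is below the prong-box bound of `jin`. [folklore] -/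
theorem β_le_βbox_jin : fd.β ≤ fd.βbox fd.jin := (min_le_right _ _).trans (min_le_left _ _)

/-- The parameter of the junction is below the prong-box bound of `jin + 1`. [folklore] -/
theorem β_le_βbox_succ : fd.β ≤ fd.βbox (fd.jin + 1) := (min_le_right _ _).trans ((min_le_right _ _).trans (min_le_left _ _))

/-- The parameter of the junction is below the prong-box bound of `jin - 1`. [folklore] -/
theorem β_le_βbox_pred : fd.β ≤ fd.βbox (fd.jin - 1) := (min_le_right _ _).trans ((min_le_right _ _).trans (min_le_right _ _))

/-- A prong box exists at the incoming prong point. [folklore] -/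
theorem nonempty_Kin : Nonempty (ProngBox fd.P hι fd.jin fd.β) := (fd.βbox_spec _).2 _ ⟨fd.β_pos, fd.β_le_βbox_jin⟩

/-- A prong box exists at the outgoing prong point. [folklore] -/
theorem nonempty_Kout (s : ℝ) : Nonempty (ProngBox fd.P hι (fd.jout s) fd.β) := by
  rcases fd.jout_eq_or s with h | h <;> rw [h]
  · exact (fd.βbox_spec _).2 _ ⟨fd.β_pos, fd.β_le_βbox_succ⟩
  · exact (fd.βbox_spec _).2 _ ⟨fd.β_pos, fd.β_le_βbox_pred⟩

/-- The chosen prong box at the incoming prong point (independent of the side). [folklore] -/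
def Kin : ProngBox fd.P hι fd.jin fd.β := Classical.choice fd.nonempty_Kin

/-- The chosen prong box at the outgoing prong point. [folklore] -/
def Kout (s : ℝ) : ProngBox fd.P hι (fd.jout s) fd.β := Classical.choice (fd.nonempty_Kout s)

/-- **The junction of the state** on the side `s`. [folklore] -/
def junction (s : ℝ) : D.WalkJunction hι := ⟨fd.v, fd.hv, fd.jin, fd.jout s, fd.β, fd.hβ, fd.Kin, fd.Kout s⟩

/-- The junction is at the arrival saddle. [folklore] -/
@[simp] theorem junction_v (s : ℝ) : (fd.junction s).v = fd.v := rfl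
/-- The junction is at a saddle. [folklore] -/
@[simp] theorem junction_hv (s : ℝ) : (fd.junction s).hv = fd.hv := rfl
/-- The incoming prong of the junction. [folklore] -/
@[simp] theorem junction_jin (s : ℝ) : (fd.junction s).jin = fd.jin := rfl
/-- The outgoing prong of the junction. [folklore] -/
@[simp] theorem junction_jout (s : ℝ) : (fd.junction s).jout = fd.jout s := rfl
/-- The parameter of the junction. [folklore] -/
@[simp] theorem junction_β (s : ℝ) : (fd.junction s).β = fd.β := rfl
/-- The incoming box of the junction. [folklore] -/
@[simp] theorem junction_Kin (s : ℝ) : (fd.junction s).Kin = fd.Kin := rfl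
/-- The outgoing box of the junction. [folklore] -/
@[simp] theorem junction_Kout (s : ℝ) : (fd.junction s).Kout = fd.Kout s := rfl

/-- **The junction turns to the side `s`.** [folklore] -/
theorem junction_turn (s : ℝ) : (fd.junction s).jout = (fd.junction s).turn s := rfl

/-- The base point of the incoming box lies on the state's leaf (on the arrival tail). [folklore] -/
theorem Kin_base_mem_leaf : fd.Kin.base ∈ F.leaf fd.st.y := fd.E.lift_mem_leaf hι fd.β_mem_Ioc

/-- The base point of the incoming box is a frontier point. [folklore] -/
theorem ι_Kin_base_mem_frontier : ι fd.Kin.base ∈ G :=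
  Fr.mem_G_of_mem_leaf fd.st.hy fd.Kin_base_mem_leaf

/-- The incoming prong point is a frontier point. [folklore] -/
theorem pt_mem_frontier : fd.P.pt fd.jin (fd.β, 0) ∈ G := by
  rw [← fd.Kin.ι_base]; exact fd.ι_Kin_base_mem_frontier

/-! ### Goodness and the next state

The state `fd` is **good** on the side `s` when its out-dart is good: `(fd.outDart s).FGood hι hbi G`. -/

/-- **The next state** of a good state: the canonical data of the exit point of the out-dart.
[folklore] -/
def next (s : ℝ) (hg : (fd.outDart s).FGood hι hbi G) : FData Fr := (fd.outDart s).fnextData Fr hg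

/-- **The next state depends only on the out-dart.** [folklore] -/
theorem next_eq_of_outDart_eq {fd fd' : FData Fr} {s : ℝ} (h : fd.outDart s = fd'.outDart s) (hg : (fd.outDart s).FGood hι hbi G) (hg' : (fd'.outDart s).FGood hι hbi G) :
    fd.next s hg = fd'.next s hg' := by
  unfold next
  have : ∀ (dt dt' : D.Dart) (_ : dt = dt') (h₁ : dt.FGood hι hbi G) (h₂ : dt'.FGood hι hbi G), dt.fnextData Fr h₁ = dt'.fnextData Fr h₂ := by
    rintro dt _ rfl _ _; rfl
  exact this _ _ h hg hg'

/-- The next state's point is the exit point of the out-dart. [folklore] -/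
theorem next_y (s : ℝ) (hg : (fd.outDart s).FGood hι hbi G) : (fd.next s hg).st.y = fd.P.horiz hι (fd.jout s) 0 fd.P.ρ := rfl

/-- The next state's point lies over the end of the outgoing prong arc. [folklore] -/
theorem ι_next_y (s : ℝ) (hg : (fd.outDart s).FGood hι hbi G) : ι (fd.next s hg).st.y = fd.P.pt (fd.jout s) (fd.P.ρ, 0) := (fd.outDart s).ι_exitPt hι

/-- The outgoing prong arc lies in the next leaf. [folklore] -/
theorem horiz_mem_leaf_next (s : ℝ) (hg : (fd.outDart s).FGood hι hbi G) {b : ℝ} (hb : b ∈ Ioc 0 fd.P.ρ) :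
    fd.P.horiz hι (fd.jout s) 0 b ∈ F.leaf (fd.next s hg).st.y :=
  (fd.outDart s).horiz_mem_leaf_exitPt hι hb

/-- The next arrival saddle is the ω-saddle of the exit point. [folklore] -/
theorem next_v (s : ℝ) (hg : (fd.outDart s).FGood hι hbi G) : (fd.next s hg).v = Fr.vω hg.fr := rfl

/-- **The α-limit set of the next leaf is the present saddle.** [folklore] -/
theorem alphaSet_next (s : ℝ) (hg : (fd.outDart s).FGood hι hbi G) : alphaSet hbi ι (fd.next s hg).st.y = {fd.v} := hg.α

/-- The canonical tail of the next state is based after its base point. [folklore] -/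
theorem base_lt_next_p (s : ℝ) (hg : (fd.outDart s).FGood hι hbi G) : leafLT hbi (Leaf.base F (fd.next s hg).st.y) (fd.next s hg).E.p :=
  FState.base_lt_canonData_p (Fr := Fr) ⟨(fd.outDart s).exitPt hι, hg.fr⟩

/-! ### The link to the next state -/

section Link

variable (s : ℝ) (hg : (fd.outDart s).FGood hι hbi G)

/-- The backward tail of the next leaf along the whole outgoing prong arc. [folklore] -/
def Eb : fd.P.BwdTail hbi (fd.next s hg).st.y := hg.eb.choose

/-- The backward tail is on the outgoing prong. [folklore] -/
theorem Eb_j : (fd.Eb s hg).j = fd.jout s := hg.eb.choose_spec.1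

/-- The backward tail is the whole prong arc. [folklore] -/
theorem Eb_β₀ : (fd.Eb s hg).β₀ = fd.P.ρ := hg.eb.choose_spec.2

/-- The base point of the backward tail is the base point of the next leaf. [folklore] -/
theorem Eb_p : (fd.Eb s hg).p = Leaf.base F (fd.next s hg).st.y := by
  apply Leaf.injective_coe F (fd.next s hg).st.y
  apply hι.injective
  show ι (Leaf.pt (fd.Eb s hg).p) = ι (fd.next s hg).st.y
  rw [(fd.Eb s hg).hp, fd.Eb_j, fd.Eb_β₀, fd.ι_next_y]

/-- The base point of the outgoing box lies on the next leaf. [folklore] -/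
theorem Kout_base_mem_leaf : (fd.Kout s).base ∈ F.leaf (fd.next s hg).st.y := by
  have h := (fd.Eb s hg).lift_mem_leaf hι (β := fd.β) (by rw [fd.Eb_β₀]; exact fd.β_mem_Ioc_ρ)
  rw [fd.Eb_j] at h
  exact h

/-- **The start of the link**: the point of the next leaf over the outgoing prong point. [folklore] -/
def linkStart : F.Leaf (fd.next s hg).st.y := Leaf.mk (fd.Kout s).base (fd.Kout_base_mem_leaf s hg)

/-- The start of the link is the base point of the outgoing box. [folklore] -/
@[simp] theorem pt_linkStart : Leaf.pt (fd.linkStart s hg) = (fd.Kout s).base := rfl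

/-- The start of the link is not after the base point of the next leaf. [folklore] -/
theorem not_lt_linkStart : ¬ leafLT hbi (Leaf.base F (fd.next s hg).st.y) (fd.linkStart s hg) := by
  have h : fd.linkStart s hg ∈ bwd hbi (fd.Eb s hg).p :=
    ((fd.Eb s hg).bwd_iff _).2 ⟨fd.β, by rw [fd.Eb_β₀]; exact fd.β_mem_Ioc_ρ, by rw [fd.pt_linkStart, (fd.Kout s).ι_base, fd.Eb_j]⟩
  rw [fd.Eb_p] at h
  exact h

/-- **The end of the link**: the point of the next leaf over the next incoming prong point. [folklore] -/
def linkEnd : F.Leaf (fd.next s hg).st.y := Leaf.mk (fd.next s hg).Kin.base (fd.next s hg).Kin_base_mem_leaf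

/-- The end of the link is the base point of the next incoming box. [folklore] -/
@[simp] theorem pt_linkEnd : Leaf.pt (fd.linkEnd s hg) = (fd.next s hg).Kin.base := rfl

/-- The end of the link is not before the base of the next tail. [folklore] -/
theorem not_linkEnd_lt : ¬ leafLT hbi (fd.linkEnd s hg) (fd.next s hg).E.p :=
  ((fd.next s hg).E.fwd_iff _).2 ⟨(fd.next s hg).β, (fd.next s hg).β_mem_Ioc, by rw [fd.pt_linkEnd, (fd.next s hg).Kin.ι_base]; rfl⟩

/-- **The link runs forward**: the tails were chosen apart. [folklore] -/
theorem linkStart_lt_linkEnd : leafLT hbi (fd.linkStart s hg) (fd.linkEnd s hg) := by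
  have h₁ := fd.not_lt_linkStart s hg
  have h₂ := fd.base_lt_next_p s hg
  have h₃ := fd.not_linkEnd_lt s hg
  have h₁₂ : leafLT hbi (fd.linkStart s hg) (fd.next s hg).E.p := by
    rcases not_leafLT_iff.1 h₁ with h | h
    · exact leafLT_trans h h₂
    · rw [h]; exact h₂
  rcases not_leafLT_iff.1 h₃ with h | h
  · exact leafLT_trans h₁₂ h
  · rw [← h]; exact h₁₂

/-- **The link**: the leaf arc of the next leaf from the outgoing prong point to the next incoming
prong point. [folklore] -/
def link : Path (fd.junction s).Kout.base ((fd.next s hg).junction s).Kin.base :=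
  (exists_leafIccPath (fd.linkStart_lt_linkEnd s hg)).choose

/-- The properties of the link: continuous in the leaf topology, injective, with range the closed
leaf interval between its ends. [folklore] -/
theorem link_spec :
    Continuous (toLeafSpace ∘ fd.link s hg : I → F.LeafSpace) ∧ Injective (fd.link s hg) ∧
      ∀ y, y ∈ range (fd.link s hg) ↔ ∃ r ∈ leafIcc hbi (fd.linkStart s hg) (fd.linkEnd s hg), Leaf.pt r = y :=
  (exists_leafIccPath (fd.linkStart_lt_linkEnd s hg)).choose_spec

/-- The link is continuous in the leaf topology. [folklore] -/
theorem continuous_toLeafSpace_link : Continuous (toLeafSpace ∘ fd.link s hg : I → F.LeafSpace) := (fd.link_spec s hg).1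

/-- The link is injective. [folklore] -/
theorem injective_link : Injective (fd.link s hg) := (fd.link_spec s hg).2.1

/-- The points of the link are on the next leaf. [folklore] -/
theorem link_mem_leaf (θ : I) : fd.link s hg θ ∈ F.leaf (fd.next s hg).st.y := by
  obtain ⟨r, -, hr⟩ := ((fd.link_spec s hg).2.2 _).1 ⟨θ, rfl⟩
  rw [← hr]; exact r.2

end Link

end FData

/-! ## The sequence of states, the junctions and the links of the hugged walk -/

namespace FData

variable {Fr}

open scoped Classical in
/-- **The sequence of states** of the hugged walk from `fd₀` on the side `s`: the next state while
good, constant afterwards. [folklore] -/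
def seq (s : ℝ) (fd₀ : FData Fr) : ℕ → FData Fr
  | 0 => fd₀
  | k + 1 => if hg : ((seq s fd₀ k).outDart s).FGood hι hbi G then (seq s fd₀ k).next s hg else seq s fd₀ k

variable (s : ℝ) (fd₀ : FData Fr)

/-- The sequence starts at `fd₀`. [folklore] -/
@[simp] theorem seq_zero : seq s fd₀ 0 = fd₀ := rfl

open scoped Classical in
/-- The recursion of the sequence of states. [folklore] -/
theorem seq_succ (k : ℕ) :
    seq s fd₀ (k + 1) = if hg : ((seq s fd₀ k).outDart s).FGood hι hbi G then (seq s fd₀ k).next s hg else seq s fd₀ k := rfl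

/-- After a good state comes its next state. [folklore] -/
theorem seq_succ_of_good {k : ℕ} (hg : ((seq s fd₀ k).outDart s).FGood hι hbi G) : seq s fd₀ (k + 1) = (seq s fd₀ k).next s hg := by
  rw [seq_succ, dif_pos hg]

/-- After a state that is not good the sequence stays. [folklore] -/
theorem seq_succ_of_not_good {k : ℕ} (hg : ¬ ((seq s fd₀ k).outDart s).FGood hι hbi G) : seq s fd₀ (k + 1) = seq s fd₀ k := by
  rw [seq_succ, dif_neg hg]

/-- **The out-darts evolve autonomously**: the out-dart of the next state is a function of the
out-dart. [folklore] -/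
theorem outDart_seq_succ_eq {k k' : ℕ} (h : (seq s fd₀ k).outDart s = (seq s fd₀ k').outDart s)
    (hg : ((seq s fd₀ k).outDart s).FGood hι hbi G) (hg' : ((seq s fd₀ k').outDart s).FGood hι hbi G) : seq s fd₀ (k + 1) = seq s fd₀ (k' + 1) := by
  rw [seq_succ_of_good s fd₀ hg, seq_succ_of_good s fd₀ hg']
  exact next_eq_of_outDart_eq h hg hg'

end FData

namespace FData

variable {Fr} (s : ℝ) (hs : s = 1 ∨ s = -1) (fd₀ : FData Fr)

/-- **The junctions of the hugged walk.** [folklore] -/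
def hugJ (k : ℕ) : D.WalkJunction hι := (FData.seq s fd₀ k).junction s

/-- **The hugged walk turns to the side `s` at every junction.** [folklore] -/
theorem hugJ_turn (k : ℕ) : (hugJ s fd₀ k).jout = (hugJ s fd₀ k).turn s := rfl

/-- The saddle of the junction `k`. [folklore] -/
@[simp] theorem hugJ_v (k : ℕ) : (hugJ s fd₀ k).v = (FData.seq s fd₀ k).v := rfl
/-- The incoming prong of the junction `k`. [folklore] -/
@[simp] theorem hugJ_jin (k : ℕ) : (hugJ s fd₀ k).jin = (FData.seq s fd₀ k).jin := rfl
/-- The outgoing prong of the junction `k`. [folklore] -/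
@[simp] theorem hugJ_jout (k : ℕ) : (hugJ s fd₀ k).jout = (FData.seq s fd₀ k).jout s := rfl
/-- The parameter of the junction `k`. [folklore] -/
@[simp] theorem hugJ_β (k : ℕ) : (hugJ s fd₀ k).β = (FData.seq s fd₀ k).β := rfl
/-- The incoming box of the junction `k`. [folklore] -/
@[simp] theorem hugJ_Kin (k : ℕ) : (hugJ s fd₀ k).Kin = (FData.seq s fd₀ k).Kin := rfl

open scoped Classical in
/-- **The links of the hugged walk**: the leaf-arc link at a good index, the junk path otherwise.
[folklore] -/
def hugLink (k : ℕ) : Path (hugJ s fd₀ k).Kout.base (hugJ s fd₀ (k + 1)).Kin.base :=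
  if hg : ((FData.seq s fd₀ k).outDart s).FGood hι hbi G then
    ((FData.seq s fd₀ k).link s hg).cast rfl (by unfold hugJ; rw [FData.seq_succ_of_good s fd₀ hg])
  else
    (WalkJunction.junkPath _ hs rfl (FData.seq s fd₀ k).β_pos).cast rfl
      (by unfold hugJ; rw [FData.seq_succ_of_not_good s fd₀ hg])

/-- At a good index the link is the leaf-arc link. [folklore] -/
theorem hugLink_apply_of_good {k : ℕ} (hg : ((FData.seq s fd₀ k).outDart s).FGood hι hbi G) (θ : I) :
    hugLink s hs fd₀ k θ = (FData.seq s fd₀ k).link s hg θ := by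
  unfold hugLink; rw [dif_pos hg]; rfl

/-- **At a good index the link is continuous in the leaf topology.** [folklore] -/
theorem continuous_toLeafSpace_hugLink {k : ℕ} (hg : ((FData.seq s fd₀ k).outDart s).FGood hι hbi G) :
    Continuous (toLeafSpace ∘ hugLink s hs fd₀ k : I → F.LeafSpace) := by
  have : (toLeafSpace ∘ hugLink s hs fd₀ k : I → F.LeafSpace) = toLeafSpace ∘ (FData.seq s fd₀ k).link s hg := by
    funext θ; simp only [comp_apply, hugLink_apply_of_good s hs fd₀ hg]
  rw [this]; exact (FData.seq s fd₀ k).continuous_toLeafSpace_link s hg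

/-- At a good index the points of the link lie on the next leaf. [folklore] -/
theorem hugLink_mem_leaf {k : ℕ} (hg : ((FData.seq s fd₀ k).outDart s).FGood hι hbi G) (θ : I) :
    hugLink s hs fd₀ k θ ∈ F.leaf (FData.seq s fd₀ (k + 1)).st.y := by
  rw [hugLink_apply_of_good s hs fd₀ hg, FData.seq_succ_of_good s fd₀ hg]
  exact (FData.seq s fd₀ k).link_mem_leaf s hg θ

end FData

end StarData

end Literature.Topology.PlanarFoliations
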